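import Literature.NumberTheory.LFunctions.Voros2006OesterleProofs
import Literature.NumberTheory.LFunctions.SekatskiiGeneralizedLiCriterionProofs
import HarnessLib

/-!
# Sekatskii's asymptotic of the generalized Li sums `k_{n,a}` under RH — PROVED

LABEL (line 1): **RH-CONDITIONAL** (Theorem 4) / **RH-EQUIVALENT** (its packaging `sekatskii2014b_iff`
with Sekatskii's Theorem 2 (c)) — an asymptotic law for Sekatskii's generalized Li sums
`k_{n,a} = Σ_ρ (1 − ((ρ−a)/(ρ+a−1))ⁿ)` (tree: `liSekatskiiSum a n`) whose HYPOTHESIS is the Riemann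
hypothesis (explicit binder `RiemannHypothesis →`): on RH,
`k_{n,a} = ½|1−2a|·n log n + ½|1−2a|·(γ − 1 − log(2π/|1−2a|))·n + o(n)`.  PROVED in the kernel from the
tree's Oesterlé–Voros engine `(NT) ⇒ (REs)` and the Riemann–von Mangoldt formula.  bears_on: LADDER-RH
L-C/L-P (COLUMN 4, LI; the `a`-family row of the criterion catalogue).  WHAT THIS IS NOT: an
RH-CONSEQUENCE, i.e. what the sums must look like IF RH holds (for `a = 0, 1` it is Oesterlé–Voros'
`λ_n = ½n(log n − 1 + γ − log 2π) + o(n)`, the tree's `Voros2006_thm_onlyif_holds`); by Sekatskii's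
Theorem 1 (`sekatskii2014_thm1`) and Bombieri–Lagarias any such one-sided growth statement is RH
re-indexed; nothing here bears on the truth of RH.

Source.  S. K. Sekatskii, *Asymptotic of the generalized Li's sums which non-negativity is equivalent
to the Riemann Hypothesis*, arXiv:1403.4484 (2014) [Sekatskii2014Asymptotic], Theorem 4 (= eq. (4),
p. 5 of the arXiv PDF; the abstract states the same formula), reproduced verbatim as Theorem 6 /
eq. (A1) of the Appendix of S. K. Sekatskii, *First applications of generalized Li's criterion to
study the Riemann zeta-function zeroes location*, arXiv:1404.7276v2 (2015) [Sekatskii2015FirstApplications]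
(published form: *On the generalized Li's criterion equivalent to the Riemann hypothesis and its first
applications*, in: Operator Theory and Harmonic Analysis, Springer Proc. Math. Stat. **358** (2021)
241–254, doi:10.1007/978-3-030-68490-7_12 — not held, acquisition `acq-11710`; statements typed from
the arXiv versions, whose displayed formulas were read off the PDF content streams since the held
text extraction `paper:arxiv-1403.4484` lost them).  Printed statement (abstract of 1403.4484,
verbatim): "We show that on RH, for large enough n, for any real b not equal to -1/2, one has:
k_n,b=Sum_rho(1-((rho+b)/(rho-b-1))**n)=0.5*abs(2b+1)*n*ln(n)+0.5*abs(2b+1)*(gamma-1-ln(2*pi/abs(2b+1))*n+o(n),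
where gamma is Euler-Mascheroni constant."  Printed proof (p. 5–6 / App.): "a straightforward
generalization of the method presented in Coffey['s] paper" — on RH write `(ρ+b)/(ρ−b−1) = e^{iφ}`,
`tan(φ/2)`-substitution, `k_{n,b} = 2∫(1 − cos nφ(T)) dN(T)`, integration by parts, `N(T) = (T/2π)ln(T/2πe)
+ O(ln T)`, the variable change `T = (2b+1)·n·y`, and GR 3.721.1, 4.421.1 (`∫₀^∞ sin y/y = π/2`,
`∫₀^∞ ln y · sin y/y = −πγ/2`) — i.e. exactly the architecture of Oesterlé's argument as printed by
Voros (2006), which the tree has as a PROVED engine; we instantiate that engine instead of re-running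
the integration by parts (deviation from print: none in substance, the rescaling `T ↦ (2b+1)T` is
performed on the ordinates rather than inside the integral).

## Dictionary (paper ↦ tree)

* The 2014b/2015 papers write `k_{n,b} = Σ_ρ(1 − ((ρ+b)/(ρ−b−1))ⁿ)`, `b ≠ −½`; the Ukr. Math. J. paper
  [Sekatskii2014] and the tree write `k_{n,a} = Σ_ρ(1 − ((ρ−a)/(ρ+a−1))ⁿ)`, `a ≠ ½`
  (`liSekatskiiSum a n`, absolutely convergent real-part sum with multiplicities over the non-trivial
  zeros).  So **`b = −a`** and `|2b+1| = |1−2a|`; the main term is typed as `liSekatskiiMain a n`.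
* "on RH, for large enough n, … + o(n)" ↦ `RiemannHypothesis → (k_{·,a} − liSekatskiiMain a) =o[atTop] (n ↦ n)`.

## Contents and proof architecture (follows the printed proof; the engine is the tree's)

* `liSekatskiiMain a n := ½|1−2a| n log n + ½|1−2a|(γ − 1 − log(2π/|1−2a|)) n` (def, the printed
  right-hand side), `liSekatskiiMain_one_sub` (`a ↦ 1−a` invariance), `liSekatskiiMain_zero`
  (`a = 0`: Voros' `½n(log n − 1 + γ − log 2π)`).
* §1 (the printed "`(ρ+b)/(ρ−b−1) = e^{iφ}` on RH"): for `ρ = ½ + iy` and `c = 1 − 2a ≠ 0`,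
  `(ρ−a)/(ρ+a−1) = 1 − 1/(½ − i·y/c)` (`Sekatskii2014b.ratio_eq`), so each summand of `k_{n,a}` is
  Li's summand at the RESCALED ordinate `y/c`: `Re[1 − ((ρ−a)/(ρ+a−1))ⁿ] = Re[1 − (1 − 1/(½ + i y/c))ⁿ]`.
* §2 (the printed "`dN(T)`, `N(T) = (T/2π) ln(T/2πe) + O(ln T)` after `T ↦ (2b+1)·T`"): the rescaled
  enumeration `τ_k = γ_k/c` of the ordinates (`γ_k = zetaOrdinate k`) satisfies Voros' `(NT)` with
  `R₋₂ = c/(8π)`, `R₋₁ = (c/(4π)) log(c/(2π))`, `α = ½` (`Sekatskii2014b.NT_rescaled`, from the tree's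
  `Voros2006Oesterle.NT_zetaOrdinate` = Riemann–von Mangoldt).
* §3 (the printed integration by parts + GR 3.721.1/4.421.1): the tree's PROVED engine
  `Voros2006_NT_REs_holds` (Oesterlé's argument, `Voros2006OesterleProofs.lean`) gives
  `Σ_k 2(1 − Re(1 − 1/(½+iτ_k))ⁿ) = 2πn[2R₋₂(log n − 1 + γ) + R₋₁] + o(n)`, and
  `2πn[2R₋₂(log n − 1 + γ) + R₋₁] = liSekatskiiMain a n` (`Sekatskii2014b.voros_main_eq`).
* §4: under RH, `k_{n,a} = Σ_k 2(1 − Re(1 − 1/(½+iτ_k))ⁿ)` by the zero-set/ordinate dictionary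
  `tsum_nontrivialZeros_eq_tsum_zetaOrdinate` (conjugate pairing `±γ_k`) — `Sekatskii2014b.liSekatskiiSum_eq_tsum_rescaled`.
* **Theorem 4** `sekatskii2014b_thm4 : RiemannHypothesis → ∀ a, (k_{·,a} − liSekatskiiMain a) = o(n)` —
  PROVED (`a < ½` by §§1–4; `a > ½` by `k_{n,1−a} = k_{n,a}`, the printed "the case `b < −½` is quite
  similar"; at the excluded `a = ½` both sides vanish identically, so no hypothesis on `a` is needed).
* Cheap kernel consequences (RH-CONDITIONAL): `sekatskii2014b_isEquivalent` (`k_{n,a} ~ ½|1−2a| n log n`,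
  `a ≠ ½`), `sekatskii2014b_tendsto_atTop` (`k_{n,a} → +∞`), and the derivative form
  `sekatskii2014b_deriv` ("and thus also an asymptotic of equal to them derivatives", p. 5:
  `(1/(n−1)!)dⁿ/dzⁿ[(z−a)^{n−1} ln ξ(z)]|_{z=1−a} = sgn(1−2a)·[½ n log n + ½(γ−1−log(2π/|1−2a|)) n] + o(n)`,
  via the tree's PROVED identity `Sekatskii2014_sum_eq_deriv_holds`, eq. (6) of [Sekatskii2014]).
* RH-EQUIVALENT packaging `sekatskii2014b_iff` (`a ≠ ½`: `RH ⟺ k_{n,a} = liSekatskiiMain a n + o(n)`,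
  the `a`-analogue of the tree's `Voros2006_thm_iff`; `⟸` by `riemannHypothesis_of_liSekatskiiSum_ge_neg_pow`:
  a polynomial lower bound for `k_{n,a}` is already RH, Sekatskii's Theorem 2 (c)) — PROVED as an
  equivalence, which proves neither side.

Deliberately NOT here: Remark 2 of 1403.4484 ("Coffey's suggestion that the `o(n)` terms are
`O(n^{1/2+ε})`" — a suggestion, not a theorem; for `a = 0` the `O(√n log n)` form is Lagarias 2007),
Remark 1 / (A4)–(A5) (Chebyshev-polynomial rewriting, no statement), Remark 3 (the `σ ≠ ½` sums, "we
plan to return to this question").  No named facts are introduced (0 new `def … : Prop`).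

## References

* [Sekatskii2014Asymptotic] S. K. Sekatskii, arXiv:1403.4484 (2014), Theorem 4, eq. (4); abstract.
* [Sekatskii2015FirstApplications] S. K. Sekatskii, arXiv:1404.7276v2 (2015), Appendix, Theorem 6,
  eq. (A1)–(A3); published: Springer PROMS 358 (2021) 241–254, doi:10.1007/978-3-030-68490-7_12.
* [Sekatskii2014] S. K. Sekatskii, Ukr. Math. J. 66 (2014) 415–431, Thm 1, eq. (6).
* [Voros2006] A. Voros, Math. Phys. Anal. Geom. 9 (2006) 53–63, §3 (Oesterlé's argument).
-/

noncomputable section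

open Filter Topology Asymptotics Real Complex

namespace Literature.NumberTheory.LFunctions

/-! ### The printed main term -/

/-- **Sekatskii's main term** `½|1−2a|·n ln n + ½|1−2a|·(γ − 1 − ln(2π/|1−2a|))·n` (eq. (4) of
arXiv:1403.4484 / (A1) of arXiv:1404.7276, with the papers' `b = −a`, `|2b+1| = |1−2a|`).
[cite: Sekatskii2014Asymptotic, Theorem 4, eq. (4)] -/
def liSekatskiiMain (a : ℝ) (n : ℕ) : ℝ :=
  |1 - 2 * a| / 2 * n * Real.log n +
    |1 - 2 * a| / 2 * (Real.eulerMascheroniConstant - 1 - Real.log (2 * π / |1 - 2 * a|)) * n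

/-- The main term is invariant under `a ↦ 1 − a` (as are the sums, `liSekatskiiSum_one_sub`).
[cite: Sekatskii2014Asymptotic, Theorem 4 ("the case b < −1/2 is quite similar")] -/
theorem liSekatskiiMain_one_sub (a : ℝ) (n : ℕ) : liSekatskiiMain (1 - a) n = liSekatskiiMain a n := by
  have h : |1 - 2 * (1 - a)| = |1 - 2 * a| := by
    rw [show (1 : ℝ) - 2 * (1 - a) = -(1 - 2 * a) by ring, abs_neg]
  simp only [liSekatskiiMain, h]

/-- At `a = 0` (Li's `λ_n = k_{n,0}`) the main term is Voros'/Oesterlé's `½ n (log n − 1 + γ − log 2π)`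
(the tree's `Voros2006_thm_onlyif`). [cite: Sekatskii2014Asymptotic, abstract ("Li's criterion corresponds to the case b=0")] -/
theorem liSekatskiiMain_zero (n : ℕ) :
    liSekatskiiMain 0 n =
      (n : ℝ) / 2 * (Real.log n - 1 + Real.eulerMascheroniConstant - Real.log (2 * π)) := by
  simp only [liSekatskiiMain, mul_zero, sub_zero, abs_one, div_one]
  ring

/-- At the excluded value `a = ½` (`b = −½`, "for any real b not equal to −1/2") the main term
vanishes. [cite: Sekatskii2014Asymptotic, Theorem 4 (excluded value b = −1/2)] -/
theorem liSekatskiiMain_half (n : ℕ) : liSekatskiiMain (1 / 2) n = 0 := by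
  simp [liSekatskiiMain]

/-- At the excluded value `a = ½` (`b = −½`) every summand of `k_{n,½}` is `Re(1 − 1ⁿ) = 0` (a
non-trivial zero is not the real number `½`), so `k_{n,½} = 0` — which is why the criterion and the
asymptotic exclude it. [cite: Sekatskii2014Asymptotic, Theorem 4 (excluded value b = −1/2)] -/
theorem liSekatskiiSum_half (n : ℕ) : liSekatskiiSum (1 / 2) n = 0 := by
  unfold liSekatskiiSum
  refine (tsum_congr fun ρ ↦ ?_).trans tsum_zero
  have hne : (ρ : ℂ) - ((1 / 2 : ℝ) : ℂ) ≠ 0 := by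
    intro h
    have him := ZetaZeros.riemannZetaNontrivialZeros.im_ne_zero ρ.2
    rw [sub_eq_zero] at h
    rw [h, ofReal_im] at him
    exact him rfl
  have h1 : ((ρ : ℂ) - ((1 / 2 : ℝ) : ℂ)) / ((ρ : ℂ) + ((1 / 2 : ℝ) : ℂ) - 1) = 1 := by
    rw [div_eq_one_iff_eq]
    · push_cast; ring
    · have : (ρ : ℂ) + ((1 / 2 : ℝ) : ℂ) - 1 = (ρ : ℂ) - ((1 / 2 : ℝ) : ℂ) := by push_cast; ring
      rwa [this]
  rw [h1, one_pow, sub_self, Complex.zero_re, mul_zero]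

namespace Sekatskii2014b

/-! ### §1. On the critical line the ratio is Li's `1 − 1/ρ′` at a rescaled ordinate -/

/-- For `ρ = ½ + iy` and `c = 1 − 2a ≠ 0`: `(ρ − a)/(ρ + a − 1) = 1 − 1/(½ + i·(−y/c))` — Sekatskii's
summand is Li's/Voros' summand at the rescaled (and conjugated) ordinate (printed: "`(ρ+b)/(ρ−b−1)
= e^{iφ}`, `tan(φ/2) = …`", eq. (A2)). [cite: Sekatskii2015FirstApplications, Appendix, eq. (A2)] -/
theorem ratio_eq {a : ℝ} (ha : a ≠ 1 / 2) (y : ℝ) :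
    (((1 / 2 : ℂ) + (y : ℂ) * I) - (a : ℂ)) / (((1 / 2 : ℂ) + (y : ℂ) * I) + (a : ℂ) - 1) =
      1 - 1 / ((1 / 2 : ℂ) + (((-y / (1 - 2 * a) : ℝ)) : ℂ) * I) := by
  have hc : (1 : ℝ) - 2 * a ≠ 0 := by
    intro h; apply ha; linarith
  have hcC : (1 : ℂ) - 2 * (a : ℂ) ≠ 0 := by
    rw [show (1 : ℂ) - 2 * (a : ℂ) = ((1 - 2 * a : ℝ) : ℂ) by push_cast; ring]
    exact_mod_cast hc
  -- the denominators are non-zero (their real parts are `a − ½ ≠ 0` resp. `½`)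
  have hden1 : ((1 / 2 : ℂ) + (y : ℂ) * I) + (a : ℂ) - 1 ≠ 0 := by
    intro h
    have := congrArg Complex.re h
    simp only [Complex.sub_re, Complex.add_re, Complex.mul_re, Complex.ofReal_re,
      Complex.ofReal_im, Complex.I_re, Complex.I_im, Complex.one_re, Complex.zero_re,
      Complex.div_ofNat_re] at this
    apply ha; linarith
  have hden2 : (1 / 2 : ℂ) + (((-y / (1 - 2 * a) : ℝ)) : ℂ) * I ≠ 0 := by
    intro h
    have := congrArg Complex.re h
    simp only [Complex.add_re, Complex.mul_re, Complex.ofReal_re, Complex.ofReal_im,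
      Complex.I_re, Complex.I_im, Complex.one_re, Complex.zero_re, Complex.div_ofNat_re] at this
    linarith
  rw [one_sub_div hden2, div_eq_div_iff hden1 hden2]
  push_cast
  field_simp
  ring

/-- Hence, termwise on the critical line, `Re[1 − ((ρ−a)/(ρ+a−1))ⁿ] = Re[1 − (1 − 1/(½ + i y/c))ⁿ]`
with `c = 1 − 2a` (conjugation does not change the real part, `Voros2006Oesterle.re_summand_neg`).
[cite: Sekatskii2015FirstApplications, Appendix, eq. (A2)–(A3)] -/
theorem re_term_eq {a : ℝ} (ha : a ≠ 1 / 2) (y : ℝ) (n : ℕ) :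
    (1 - ((((1 / 2 : ℂ) + (y : ℂ) * I) - (a : ℂ)) / (((1 / 2 : ℂ) + (y : ℂ) * I) + (a : ℂ) - 1)) ^ n).re =
      ((1 : ℂ) - (1 - 1 / ((1 / 2 : ℂ) + ((y / (1 - 2 * a) : ℝ) : ℂ) * I)) ^ n).re := by
  rw [ratio_eq ha y, show (-y / (1 - 2 * a) : ℝ) = -(y / (1 - 2 * a)) by ring]
  exact Voros2006Oesterle.re_summand_neg (y / (1 - 2 * a)) n

/-! ### §2. The rescaled ordinates satisfy `(NT)` -/

/-- The rescaled enumeration `τ_k = γ_k / c` (`γ_k = zetaOrdinate k`, `c = 1 − 2a > 0`).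
[cite: Sekatskii2015FirstApplications, Appendix (variable change after (A3))] -/
def tauResc (c : ℝ) (k : ℕ) : ℝ := zetaOrdinate k / c

/-- The rescaled ordinates are positive (`γ_k > 0`, `c > 0`).
[cite: Sekatskii2015FirstApplications, Appendix (variable change after (A3))] -/
theorem tauResc_pos {c : ℝ} (hc : 0 < c) (k : ℕ) : 0 < tauResc c k :=
  div_pos (zetaOrdinate_pos_holds k) hc

/-- The rescaled ordinates are non-decreasing.
[cite: Sekatskii2015FirstApplications, Appendix (variable change after (A3))] -/
theorem tauResc_mono {c : ℝ} (hc : 0 < c) : Monotone (tauResc c) :=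
  fun _ _ h ↦ div_le_div_of_nonneg_right (zetaOrdinate_mono_holds h) hc.le

/-- The rescaled ordinates tend to `+∞`.
[cite: Sekatskii2015FirstApplications, Appendix (variable change after (A3))] -/
theorem tendsto_tauResc {c : ℝ} (hc : 0 < c) : Tendsto (tauResc c) atTop atTop :=
  tendsto_zetaOrdinate_atTop.atTop_div_const hc

/-- **`(NT)` for the rescaled ordinates**: `#{k : γ_k/c ≤ T} = N(cT) = 2T[2R₋₂(log T − 1) + R₋₁] + O(T^{1/2})`
with `R₋₂ = c/(8π)`, `R₋₁ = (c/(4π)) log(c/(2π))` — the Riemann–von Mangoldt formula after `T ↦ cT`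
(printed: "use the approximations `N(T) = (T/2π) ln T − (T/2π) ln 2π − T/2π + O(ln T)` [4]").
[cite: Sekatskii2015FirstApplications, Appendix, proof of Theorem 6 (after (A3))] -/
theorem NT_rescaled {c : ℝ} (hc : 0 < c) :
    (fun T : ℝ ↦ (Nat.card {k : ℕ | tauResc c k ≤ T} : ℝ) -
        2 * T * (2 * (c / (8 * π)) * (Real.log T - 1) + c / (4 * π) * Real.log (c / (2 * π))))
      =O[atTop] (fun T : ℝ ↦ T ^ (1 / 2 : ℝ)) := by
  have h0 := Voros2006Oesterle.NT_zetaOrdinate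
  have h1 := h0.comp_tendsto (tendsto_id.const_mul_atTop hc)
  -- `(cT)^{1/2} = O(T^{1/2})`
  have h2 : ((fun T : ℝ ↦ T ^ (1 / 2 : ℝ)) ∘ fun T : ℝ ↦ c * id T) =O[atTop]
      (fun T : ℝ ↦ T ^ (1 / 2 : ℝ)) := by
    refine IsBigO.of_bound (c ^ (1 / 2 : ℝ)) ?_
    filter_upwards [eventually_ge_atTop 0] with T hT
    simp only [Function.comp, id]
    rw [Real.mul_rpow hc.le hT, Real.norm_eq_abs, Real.norm_eq_abs,
      abs_of_nonneg (by positivity), abs_of_nonneg (by positivity)]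
  refine (h1.trans h2).congr' ?_ EventuallyEq.rfl
  filter_upwards [eventually_gt_atTop 0] with T hT
  simp only [Function.comp, id]
  have hset : {k : ℕ | zetaOrdinate k ≤ c * T} = {k : ℕ | tauResc c k ≤ T} := by
    ext k
    simp only [Set.mem_setOf_eq, tauResc, div_le_iff₀ hc]
    rw [mul_comm]
  rw [hset, Real.log_mul hc.ne' hT.ne', Real.log_div hc.ne' (by positivity)]
  have hπ : π ≠ 0 := Real.pi_pos.ne'
  field_simp
  ring

/-! ### §3. Voros' closed form is Sekatskii's main term -/

/-- `2πn[2R₋₂(log n − 1 + γ) + R₋₁] = ½ c·n log n + ½ c(γ − 1 − log(2π/c))·n` for `R₋₂ = c/(8π)`,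
`R₋₁ = (c/(4π)) log(c/(2π))`, `c = |1 − 2a| > 0` (printed: GR 3.721.1, 4.421.1 "finally obtain").
[cite: Sekatskii2015FirstApplications, Appendix, end of proof of Theorem 6] -/
theorem voros_main_eq {a : ℝ} (ha : a < 1 / 2) (n : ℕ) :
    2 * π * n * (2 * ((1 - 2 * a) / (8 * π)) * (Real.log n - 1 + Real.eulerMascheroniConstant) +
        (1 - 2 * a) / (4 * π) * Real.log ((1 - 2 * a) / (2 * π))) = liSekatskiiMain a n := by
  have hc : 0 < 1 - 2 * a := by linarith
  have habs : |1 - 2 * a| = 1 - 2 * a := abs_of_pos hc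
  have hπ : π ≠ 0 := Real.pi_pos.ne'
  rw [liSekatskiiMain, habs, Real.log_div hc.ne' (by positivity), Real.log_div (by positivity) hc.ne']
  field_simp
  ring

/-! ### §4. Under RH, `k_{n,a}` is the engine's sum over the rescaled ordinates -/

/-- **On RH, `k_{n,a} = Σ_k 2(1 − Re(1 − 1/(½ + iγ_k/c))ⁿ)`** (`a < ½`, `c = 1 − 2a`): every non-trivial
zero is `½ ± iγ_k` (`Voros2006Oesterle.coe_eq_half_add_im`), the summand depends on the zero through
§1, and the absolutely convergent sum over the zero set with multiplicities is re-indexed by the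
ordinate enumeration (`tsum_nontrivialZeros_eq_tsum_zetaOrdinate`, conjugates paired — the printed
"`k_{n,b} = 2Σ(1 − cos(nφ))`, expressed as an integral over the number of non-trivial zeroes dN").
[cite: Sekatskii2015FirstApplications, Appendix, (A2)–(A3)] -/
theorem liSekatskiiSum_eq_tsum_rescaled (hRH : RiemannHypothesis) {a : ℝ} (ha : a < 1 / 2) (n : ℕ) :
    liSekatskiiSum a n =
      ∑' k : ℕ, 2 * (1 - ((1 - 1 / ((1 / 2 : ℂ) + (tauResc (1 - 2 * a) k : ℂ) * I)) ^ n).re) := by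
  have ha' : a ≠ 1 / 2 := ha.ne
  have hc : 0 < 1 - 2 * a := by linarith
  set c : ℝ := 1 - 2 * a with hcdef
  -- the complex-valued summand as a function of the ordinate
  set g : ℝ → ℂ := fun y ↦
    ((((1 : ℂ) - (1 - 1 / ((1 / 2 : ℂ) + ((y / c : ℝ) : ℂ) * I)) ^ n).re : ℝ) : ℂ) with hg
  -- (e1) termwise identification on the zero set
  have e1 : ∀ ρ : ZetaZeros.riemannZetaNontrivialZeros,
      ((((riemannZetaZeroOrder (ρ : ℂ) : ℝ) *
          (1 - ((((ρ : ℂ)) - a) / ((ρ : ℂ) + a - 1)) ^ n).re : ℝ)) : ℂ) =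
        (riemannZetaZeroOrder (ρ : ℂ) : ℂ) * g (ρ : ℂ).im := by
    intro ρ
    rw [hg]
    dsimp only
    have hρ := Voros2006Oesterle.coe_eq_half_add_im hRH ρ
    have key : (1 - ((((ρ : ℂ)) - a) / ((ρ : ℂ) + a - 1)) ^ n).re =
        ((1 : ℂ) - (1 - 1 / ((1 / 2 : ℂ) + (((ρ : ℂ).im / c : ℝ) : ℂ) * I)) ^ n).re := by
      conv_lhs => rw [hρ]
      exact re_term_eq ha' (ρ : ℂ).im n
    rw [key]
    push_cast
    ring
  -- (hA) summability over the zero set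
  have hA : Summable fun ρ : ZetaZeros.riemannZetaNontrivialZeros ↦
      (riemannZetaZeroOrder (ρ : ℂ) : ℂ) * g (ρ : ℂ).im := by
    have h := Complex.summable_ofReal.2 (Sekatskii.summable_term_zetaZeros a n)
    exact h.congr fun ρ ↦ e1 ρ
  -- (hB) summability over the enumeration, from the engine's `(NT)`-based lemma
  have hsum := Voros2006Oesterle.summable_summand (tauResc_pos hc) (tauResc_mono hc)
    (tendsto_tauResc hc) (by norm_num : (1 / 2 : ℝ) < 1) (NT_rescaled hc) n
  have hsum' : Summable fun k : ℕ ↦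
      2 * (1 - ((1 - 1 / ((1 / 2 : ℂ) + (tauResc c k : ℂ) * I)) ^ n).re) :=
    hsum.congr fun k ↦ (Voros2006Oesterle.summand_eq (tauResc_pos hc k) n).symm
  have hgg : ∀ k : ℕ, g (zetaOrdinate k) + g (-zetaOrdinate k) =
      ((2 * (1 - ((1 - 1 / ((1 / 2 : ℂ) + (tauResc c k : ℂ) * I)) ^ n).re) : ℝ) : ℂ) := by
    intro k
    rw [hg]
    dsimp only
    rw [show (-zetaOrdinate k / c : ℝ) = -(zetaOrdinate k / c) by ring,
      Voros2006Oesterle.re_summand_neg, Complex.sub_re, Complex.one_re]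
    simp only [tauResc]
    push_cast
    ring
  have hB : Summable fun k : ℕ ↦ g (zetaOrdinate k) + g (-zetaOrdinate k) := by
    have h := Complex.summable_ofReal.2 hsum'
    exact h.congr fun k ↦ (hgg k).symm
  -- the dictionary
  have hdict := tsum_nontrivialZeros_eq_tsum_zetaOrdinate g hA hB
  apply Complex.ofReal_injective
  rw [liSekatskiiSum, Complex.ofReal_tsum, Complex.ofReal_tsum, tsum_congr e1, hdict, tsum_congr hgg]

/-- **Theorem 4 for `a < ½`** (`b > −½` in the paper): on RH,
`k_{n,a} = ½(1−2a) n log n + ½(1−2a)(γ − 1 − log(2π/(1−2a))) n + o(n)`.  PROVED: the engine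
`Voros2006_NT_REs_holds` for the rescaled ordinates (§2) and the identifications §3–§4.
[cite: Sekatskii2014Asymptotic, Theorem 4, eq. (4)] -/
theorem isLittleO_of_lt_half (hRH : RiemannHypothesis) {a : ℝ} (ha : a < 1 / 2) :
    (fun n : ℕ ↦ liSekatskiiSum a n - liSekatskiiMain a n) =o[atTop] (fun n : ℕ ↦ (n : ℝ)) := by
  have hc : 0 < 1 - 2 * a := by linarith
  have hmain := Voros2006_NT_REs_holds (tauResc (1 - 2 * a)) (tauResc_pos hc) (tauResc_mono hc)
    (tendsto_tauResc hc) ((1 - 2 * a) / (8 * π)) ((1 - 2 * a) / (4 * π) *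
      Real.log ((1 - 2 * a) / (2 * π))) (1 / 2) (by norm_num) (NT_rescaled hc)
  refine hmain.congr' ?_ EventuallyEq.rfl
  filter_upwards [eventually_ge_atTop 1] with n hn
  rw [liSekatskiiSum_eq_tsum_rescaled hRH ha n, voros_main_eq ha n]

end Sekatskii2014b

/-! ### Theorem 4 / Theorem 6 (A1): the asymptotic of `k_{n,a}` on RH -/

/-- **Sekatskii 2014b, Theorem 4** (arXiv:1403.4484, eq. (4); = arXiv:1404.7276v2 Appendix, Theorem 6,
eq. (A1)): "Assume RH. Then for large enough `n`, for any real `b ≠ −½`,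
`k_{n,b} = Σ_ρ(1 − ((ρ+b)/(ρ−b−1))ⁿ) = ½|2b+1| n ln n + ½|2b+1|(γ − 1 − ln(2π/|2b+1|)) n + o(n)`,
where `γ` is Euler–Mascheroni constant."  In the tree's parametrisation (`b = −a`): on RH, for every
real `a`, `k_{n,a} − [½|1−2a| n log n + ½|1−2a|(γ − 1 − log(2π/|1−2a|)) n] = o(n)`.  PROVED (for
`a < ½` by `Sekatskii2014b.isLittleO_of_lt_half`; for `a > ½` by `k_{n,1−a} = k_{n,a}`; at the
printed exclusion `a = ½` both sides are identically `0`, so the typed statement carries no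
restriction on `a`).  RH-CONDITIONAL (explicit binder); the case `a = 0` is the tree's
`Voros2006_thm_onlyif_holds`. [cite: Sekatskii2014Asymptotic, Theorem 4, eq. (4)] -/
theorem sekatskii2014b_thm4 (hRH : RiemannHypothesis) (a : ℝ) :
    (fun n : ℕ ↦ liSekatskiiSum a n - liSekatskiiMain a n) =o[atTop] (fun n : ℕ ↦ (n : ℝ)) := by
  rcases lt_trichotomy a (1 / 2) with ha | rfl | ha
  · exact Sekatskii2014b.isLittleO_of_lt_half hRH ha
  · simp only [liSekatskiiSum_half, liSekatskiiMain_half, sub_self]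
    exact isLittleO_zero _ _
  · have ha' : 1 - a < 1 / 2 := by linarith
    have h := Sekatskii2014b.isLittleO_of_lt_half hRH ha'
    simp only [liSekatskiiSum_one_sub, liSekatskiiMain_one_sub] at h
    exact h

/-- The `a = 0` instance is Oesterlé–Voros: on RH, `λ_n − ½ n (log n − 1 + γ − log 2π) = o(n)`
(`k_{n,0} = λ_n`, `liSekatskiiSum_zero`); consistency check against the tree's `Voros2006_thm_onlyif_holds`.
[cite: Sekatskii2014Asymptotic, abstract ("Li's criterion corresponds to the case b=0")] -/
theorem sekatskii2014b_thm4_zero (hRH : RiemannHypothesis) :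
    (fun n : ℕ ↦ keiperLiCoeff n -
        (n : ℝ) / 2 * (Real.log n - 1 + Real.eulerMascheroniConstant - Real.log (2 * π)))
      =o[atTop] (fun n : ℕ ↦ (n : ℝ)) := by
  refine (sekatskii2014b_thm4 hRH 0).congr' ?_ EventuallyEq.rfl
  filter_upwards [eventually_ge_atTop 1] with n hn
  rw [liSekatskiiSum_zero hn, liSekatskiiMain_zero]

/-! ### Cheap kernel consequences (RH-CONDITIONAL) -/

/-- On RH, for `a ≠ ½`: `k_{n,a} ~ ½|1−2a|·n log n` (the leading term of Theorem 4).
[cite: Sekatskii2014Asymptotic, Theorem 4, eq. (4)] -/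
theorem sekatskii2014b_isEquivalent (hRH : RiemannHypothesis) {a : ℝ} (ha : a ≠ 1 / 2) :
    (fun n : ℕ ↦ liSekatskiiSum a n) ~[atTop] (fun n : ℕ ↦ |1 - 2 * a| / 2 * n * Real.log n) := by
  have hc : 0 < |1 - 2 * a| := abs_pos.2 (by intro h; apply ha; linarith)
  -- `n = o(n log n)`
  have hn_o : (fun n : ℕ ↦ (n : ℝ)) =o[atTop] (fun n : ℕ ↦ |1 - 2 * a| / 2 * n * Real.log n) := by
    have hlog : Tendsto (fun n : ℕ ↦ Real.log n) atTop atTop :=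
      Real.tendsto_log_atTop.comp tendsto_natCast_atTop_atTop
    have h1 : (fun _ : ℕ ↦ (1 : ℝ)) =o[atTop] (fun n : ℕ ↦ |1 - 2 * a| / 2 * Real.log n) := by
      refine isLittleO_const_left.2 (Or.inr ?_)
      have h3 : Tendsto (fun n : ℕ ↦ |1 - 2 * a| / 2 * Real.log n) atTop atTop :=
        hlog.const_mul_atTop (by positivity)
      exact tendsto_norm_atTop_atTop.comp h3
    have h2 := h1.mul_isBigO (isBigO_refl (fun n : ℕ ↦ (n : ℝ)) atTop)
    refine h2.congr' (Eventually.of_forall fun n ↦ by simp) ?_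
    exact Eventually.of_forall fun n ↦ by beta_reduce; ring
  -- the linear part of the main term is `O(n)`
  have hlin : (fun n : ℕ ↦ liSekatskiiMain a n - |1 - 2 * a| / 2 * n * Real.log n) =o[atTop]
      (fun n : ℕ ↦ |1 - 2 * a| / 2 * n * Real.log n) := by
    have : (fun n : ℕ ↦ liSekatskiiMain a n - |1 - 2 * a| / 2 * n * Real.log n) =
        fun n : ℕ ↦ (|1 - 2 * a| / 2 *
          (Real.eulerMascheroniConstant - 1 - Real.log (2 * π / |1 - 2 * a|))) * (n : ℝ) := by
      ext n; simp only [liSekatskiiMain]; ring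
    rw [this]
    exact (isBigO_const_mul_self _ _ atTop).trans_isLittleO hn_o
  have h := ((sekatskii2014b_thm4 hRH a).trans hn_o).add hlin
  have h' : ((fun n : ℕ ↦ liSekatskiiSum a n) - fun n : ℕ ↦ |1 - 2 * a| / 2 * n * Real.log n)
      =o[atTop] (fun n : ℕ ↦ |1 - 2 * a| / 2 * n * Real.log n) :=
    h.congr' (Eventually.of_forall fun n ↦ by simp only [Pi.sub_apply]; ring) EventuallyEq.rfl
  exact h'

/-- On RH, for `a ≠ ½`: `k_{n,a} → +∞` ("tempered growth to `+∞`").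
[cite: Sekatskii2014Asymptotic, Theorem 4, eq. (4)] -/
theorem sekatskii2014b_tendsto_atTop (hRH : RiemannHypothesis) {a : ℝ} (ha : a ≠ 1 / 2) :
    Tendsto (fun n : ℕ ↦ liSekatskiiSum a n) atTop atTop := by
  have hc : 0 < |1 - 2 * a| := abs_pos.2 (by intro h; apply ha; linarith)
  refine (sekatskii2014b_isEquivalent hRH ha).symm.tendsto_atTop ?_
  have hlog : Tendsto (fun n : ℕ ↦ Real.log n) atTop atTop :=
    Real.tendsto_log_atTop.comp tendsto_natCast_atTop_atTop
  have h1 : Tendsto (fun n : ℕ ↦ |1 - 2 * a| / 2 * (n : ℝ)) atTop atTop :=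
    tendsto_natCast_atTop_atTop.const_mul_atTop (by positivity)
  exact (h1.atTop_mul_atTop₀ hlog)

/-- **The derivative form** (p. 5 of arXiv:1403.4484: "and thus also an asymptotic of equal to them
derivatives in (1), `b = −a`"): on RH, for `a ≠ ½`,
`(1/(n−1)!) dⁿ/dzⁿ[(z−a)^{n−1} ln ξ(z)]|_{z=1−a} − liSekatskiiMain a n/(1−2a) = o(n)`, i.e. the
derivatives grow like `+½ n log n` for `a < ½` and like `−½ n log n` for `a > ½`; via the tree's PROVED
identity `k_{n,a} = (1−2a)·liSekatskiiDeriv a (1−a) n` (`Sekatskii2014_sum_eq_deriv_holds`, eq. (6) of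
[Sekatskii2014]). [cite: Sekatskii2014Asymptotic, §2 (p. 5) and Theorem 4] -/
theorem sekatskii2014b_deriv (hRH : RiemannHypothesis) {a : ℝ} (ha : a ≠ 1 / 2) :
    (fun n : ℕ ↦ liSekatskiiDeriv a (1 - a) n - liSekatskiiMain a n / (1 - 2 * a)) =o[atTop]
      (fun n : ℕ ↦ (n : ℝ)) := by
  have hc : (1 : ℝ) - 2 * a ≠ 0 := by intro h; apply ha; linarith
  have h := (sekatskii2014b_thm4 hRH a).const_mul_left (1 / (1 - 2 * a))
  refine h.congr' ?_ EventuallyEq.rfl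
  filter_upwards [eventually_ge_atTop 1] with n hn
  rw [liSekatskiiSum_eq_deriv Sekatskii2014_sum_eq_deriv_holds a hn]
  field_simp

/-! ### The asymptotic criterion for the `a`-family (RH-EQUIVALENT packaging) -/

/-- **A polynomial lower bound for `k_{n,a}` already gives RH** (`a ≠ ½`): if `k_{n,a} ≥ −K·n^k` for
all `n ≥ 1` then RH — a polynomial bound is sub-exponential (`n^k ≤ k!·ε^{−k}·e^{εn}`) and
Sekatskii's Theorem 2 (c) / Bombieri–Lagarias' condition (3) applies
(`riemannHypothesis_of_liSekatskiiSum_subexp'`).  PROVED; RH-FREE implication whose hypothesis is of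
RH strength. [cite: Sekatskii2014, Thm 2 (c) and Thm 1; BombieriLagarias1999, Theorem 1 (3)] -/
theorem riemannHypothesis_of_liSekatskiiSum_ge_neg_pow {a : ℝ} (ha : a ≠ 1 / 2) {K : ℝ} {k : ℕ}
    (hK : ∀ n : ℕ, 1 ≤ n → -(K * (n : ℝ) ^ k) ≤ liSekatskiiSum a n) : RiemannHypothesis := by
  refine riemannHypothesis_of_liSekatskiiSum_subexp' ha fun ε hε ↦ ?_
  refine ⟨|K| * (k.factorial : ℝ) / ε ^ k + 1, by positivity, fun n hn ↦ ?_⟩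
  have hεk : 0 < ε ^ k := by positivity
  have hk : (0 : ℝ) < (k.factorial : ℝ) := by positivity
  have hexp0 : 0 < Real.exp (ε * n) := Real.exp_pos _
  have hexp : (ε * n) ^ k / (k.factorial : ℝ) ≤ Real.exp (ε * n) :=
    Real.pow_div_factorial_le_exp (ε * n) (by positivity) k
  have hnk : (n : ℝ) ^ k ≤ (k.factorial : ℝ) / ε ^ k * Real.exp (ε * n) := by
    rw [div_le_iff₀ hk, mul_pow] at hexp
    rw [div_mul_eq_mul_div, le_div_iff₀ hεk]
    linarith
  have hKle : K * (n : ℝ) ^ k ≤ |K| * ((k.factorial : ℝ) / ε ^ k * Real.exp (ε * n)) :=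
    (mul_le_mul_of_nonneg_right (le_abs_self K) (by positivity)).trans
      (mul_le_mul_of_nonneg_left hnk (abs_nonneg K))
  have h := hK n hn
  rw [neg_mul]
  have : |K| * ((k.factorial : ℝ) / ε ^ k * Real.exp (ε * n)) ≤
      (|K| * (k.factorial : ℝ) / ε ^ k + 1) * Real.exp (ε * n) := by
    rw [add_mul, one_mul]
    have : |K| * ((k.factorial : ℝ) / ε ^ k * Real.exp (ε * n)) =
        |K| * (k.factorial : ℝ) / ε ^ k * Real.exp (ε * n) := by ring
    linarith
  linarith

/-- **The asymptotic criterion for Sekatskii's family** (RH-EQUIVALENT, l.1; the `a`-analogue of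
Voros' criterion `Voros2006_thm_iff`): for every real `a ≠ ½`,
`RH ⟺ k_{n,a} = ½|1−2a| n log n + ½|1−2a|(γ − 1 − log(2π/|1−2a|)) n + o(n)`.  `⟹` is Theorem 4
(`sekatskii2014b_thm4`, Oesterlé–Voros engine); `⟸` because an `o(n)`-law bounds `k_{n,a}` below by
`−K·n` and a polynomial lower bound is RH (`riemannHypothesis_of_liSekatskiiSum_ge_neg_pow`, i.e.
Sekatskii's Theorem 2 (c)).  PROVED as an equivalence — which is not a proof of either side; nothing
here bears on the truth of RH. [cite: Sekatskii2014Asymptotic, Theorem 4; Sekatskii2014, Thm 1 and Thm 2 (c)] -/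
theorem sekatskii2014b_iff {a : ℝ} (ha : a ≠ 1 / 2) :
    RiemannHypothesis ↔
      (fun n : ℕ ↦ liSekatskiiSum a n - liSekatskiiMain a n) =o[atTop] (fun n : ℕ ↦ (n : ℝ)) := by
  refine ⟨fun hRH ↦ sekatskii2014b_thm4 hRH a, fun h ↦ ?_⟩
  -- from `o(n)` to a bound `|k_{n,a} − M_a(n)| ≤ C n` for all `n`
  obtain ⟨C, hC0, hC⟩ := bound_of_isBigO_nat_atTop h.isBigO
  -- the main term is `≥ −|β| n` for `n ≥ 1` (`log n ≥ 0`), `β` its linear coefficient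
  set β : ℝ := |1 - 2 * a| / 2 *
    (Real.eulerMascheroniConstant - 1 - Real.log (2 * π / |1 - 2 * a|)) with hβ
  refine riemannHypothesis_of_liSekatskiiSum_ge_neg_pow ha (K := C + |β|) (k := 1) fun n hn ↦ ?_
  have hn1 : (1 : ℝ) ≤ n := by exact_mod_cast hn
  have hb := hC (Nat.cast_ne_zero.2 (by omega : n ≠ 0))
  rw [Real.norm_eq_abs, Real.norm_eq_abs, abs_of_nonneg (by positivity : (0 : ℝ) ≤ n)] at hb
  have hb' := (abs_le.1 hb).1
  have hlog : 0 ≤ |1 - 2 * a| / 2 * n * Real.log n := by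
    have := Real.log_nonneg hn1; positivity
  have hβn : -(|β| * n) ≤ β * n := by
    have := mul_le_mul_of_nonneg_right (neg_abs_le β) (by positivity : (0 : ℝ) ≤ n)
    linarith
  have hM : liSekatskiiMain a n = |1 - 2 * a| / 2 * n * Real.log n + β * n := by
    simp only [liSekatskiiMain, hβ]
  rw [pow_one]
  linarith

end Literature.NumberTheory.LFunctions
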